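import Literature.RepresentationTheory.HeisenbergGroup.LatticeModel
import Mathlib.Analysis.Normed.Group.Tannery
import HarnessLib

/-!
# The lattice model has continuous orbit maps

Topic `RepresentationTheory/HeisenbergGroup`; namespace `Literature.RepresentationTheory.HeisenbergGroup.LatticeModel`.
KERNEL ONLY: theorems; no definition, no named fact, no `sorry`.

Continuation of `LatticeModel.lean`: when `B₁ ≤ X`, `B₂ ≤ Y` are OPEN subgroups of topological groups, `ψ` is
continuous and the pairing `β` is jointly continuous, the orbit maps `w ↦ rep (w, 0) F` of the lattice model on
`ℓ²(A\H; E)` are continuous (**`continuous_rep_mk_zero`**) — the hypothesis `hτc` of the tree's uniqueness theorems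
(`StoneVonNeumannLatticePair`, `HeisenbergPairUniqueness`) and, with the central character, the continuity clause of
the printed `ρ_ψ` ([GelbartRogawski1991, §3.1 p. 454 L19–21] "unitary representation of `H_𝐀(W)`").  Proof: on the
open subgroup `B₁ × B₂` the action is diagonal with phases `χ_q(u) → 1` (`u → 0`), so `‖rep(u,0)F − F‖² =
Σ_q |χ_q(u) − 1|² ‖F q‖² → 0` by dominated convergence for series (Tannery); a general base point is reached by a
translation and a central phase.

## References
* [MoeglinVignerasWaldspurger1987] C. Mœglin, M.-F. Vignéras, J.-L. Waldspurger, LNM 1291 (1987), Chap. 2, I.3, II.8.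
* [Weil1964] A. Weil, Acta Math. 111 (1964), Chap. I n° 12–13.
* [GelbartRogawski1991] S. Gelbart, J. Rogawski, Invent. Math. 105 (1991), §3.1 p. 454 L19–21.
-/

set_option autoImplicit false

noncomputable section

open Filter Topology
open scoped ENNReal

namespace Literature.RepresentationTheory.HeisenbergGroup

namespace LatticeModel

variable {Rf : Type*} [CommRing Rf] {Xf Yf : Type*} [AddCommGroup Xf] [Module Rf Xf] [AddCommGroup Yf] [Module Rf Yf]
  (β : Xf →ₗ[Rf] Yf →ₗ[Rf] Rf) (ψ : AddChar Rf Circle) (B₁ : AddSubgroup Xf) (B₂ : AddSubgroup Yf)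
  (E : Type*) [NormedAddCommGroup E] [InnerProductSpace ℂ E]
  (hψ : ∀ x ∈ B₁, ∀ y ∈ B₂, ψ (β x y) = 1)

/-- on the lattice `B₁ × B₂` the action is diagonal: `(rep (u, 0) F) q = ψ(β (sec q)₁ u₂ − β u₁ (sec q)₂) • F q`.
[cite: MoeglinVignerasWaldspurger1987, Chap. 2 I.3] -/
theorem rep_mk_zero_apply_of_mem {u : Xf × Yf} (hu : u ∈ B₁.prod B₂)
    (F : lp (fun _ : (Xf × Yf) ⧸ B₁.prod B₂ => E) 2) (q : (Xf × Yf) ⧸ B₁.prod B₂) :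
    rep β ψ B₁ B₂ E hψ ⟨u, 0⟩ F q =
      ((ψ (β (sec B₁ B₂ q).1 u.2 - β u.1 (sec B₁ B₂ q).2) : Circle) : ℂ) • F q := by
  have hq : (QuotientAddGroup.mk (sec B₁ B₂ q + u) : (Xf × Yf) ⧸ B₁.prod B₂) = q := by
    rw [QuotientAddGroup.mk_add, mk_sec, (QuotientAddGroup.eq_zero_iff u).2 hu, add_zero]
  rw [rep_apply, (QuotientAddGroup.eq_zero_iff u).2 hu, add_zero]
  congr 2
  unfold phase
  simp only [Heisenberg.mul_v, Heisenberg.mul_t, polar_apply, hq, zero_add, add_sub_cancel_left]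

/-- the translation identity `(w, 0) = (w − w₀, 0) · (w₀, 0) · (0, −β (w − w₀)₁ (w₀)₂)` read on the representation:
`rep (w, 0) F = ψ(−β (w − w₀)₁ (w₀)₂) • rep (w − w₀, 0) (rep (w₀, 0) F)`. [cite: Weil1964, Chap. I n° 12–13] -/
theorem rep_mk_zero_eq_translate (w w₀ : Xf × Yf) (F : lp (fun _ : (Xf × Yf) ⧸ B₁.prod B₂ => E) 2) :
    rep β ψ B₁ B₂ E hψ ⟨w, 0⟩ F =
      ((ψ (-(β (w - w₀).1 w₀.2)) : Circle) : ℂ) •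
        rep β ψ B₁ B₂ E hψ ⟨w - w₀, 0⟩ (rep β ψ B₁ B₂ E hψ ⟨w₀, 0⟩ F) := by
  have hw : (⟨w, 0⟩ : Heisenberg (polar β)) =
      ⟨w - w₀, 0⟩ * ⟨w₀, 0⟩ * Heisenberg.ofCenter (polar β) (Multiplicative.ofAdd (-(β (w - w₀).1 w₀.2))) := by
    apply Heisenberg.ext
    · change w = w - w₀ + w₀ + 0
      rw [sub_add_cancel, add_zero]
    · change (0 : Rf) = 0 + 0 + β (w - w₀).1 w₀.2 + -(β (w - w₀).1 w₀.2) + polar β (w - w₀ + w₀) 0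
      rw [map_zero, zero_add, zero_add, add_neg_cancel, add_zero]
  rw [hw, map_mul, map_mul, Module.End.mul_apply, Module.End.mul_apply, rep_ofCenter, map_smul, map_smul]

variable [TopologicalSpace Rf] [IsTopologicalAddGroup Rf] [TopologicalSpace Xf] [IsTopologicalAddGroup Xf]
  [TopologicalSpace Yf] [IsTopologicalAddGroup Yf]
  (hB₁ : IsOpen (B₁ : Set Xf)) (hB₂ : IsOpen (B₂ : Set Yf)) (hψc : Continuous ψ)
  (hβc : Continuous fun p : Xf × Yf => β p.1 p.2)

include hB₁ hB₂ hψc hβc in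
omit [IsTopologicalAddGroup Xf] [IsTopologicalAddGroup Yf] in
/-- **continuity at the origin**: `rep (u, 0) F → F` as `u → 0` (Tannery's theorem on the diagonal formula over the
open subgroup `B₁ × B₂`). [cite: MoeglinVignerasWaldspurger1987, Chap. 2 I.3] -/
theorem tendsto_rep_mk_zero (F : lp (fun _ : (Xf × Yf) ⧸ B₁.prod B₂ => E) 2) :
    Tendsto (fun u : Xf × Yf => rep β ψ B₁ B₂ E hψ ⟨u, 0⟩ F) (𝓝 0) (𝓝 F) := by
  have h2 : 0 < (2 : ℝ≥0∞).toReal := by norm_num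
  -- the phases `χ_q(u)` and their continuity
  set χ : (Xf × Yf) ⧸ B₁.prod B₂ → Xf × Yf → ℂ := fun q u =>
    ((ψ (β (sec B₁ B₂ q).1 u.2 - β u.1 (sec B₁ B₂ q).2) : Circle) : ℂ) with hχ
  have hχc : ∀ q, Continuous (χ q) := fun q => by
    refine continuous_subtype_val.comp (hψc.comp ?_)
    exact (hβc.comp (continuous_const.prodMk continuous_snd)).sub
      (hβc.comp (continuous_fst.prodMk continuous_const))
  have hχ0 : ∀ q, χ q 0 = 1 := fun q => by
    simp only [hχ, Prod.snd_zero, Prod.fst_zero, map_zero, LinearMap.zero_apply, sub_zero, AddChar.map_zero_eq_one,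
      Circle.coe_one]
  have hA : ∀ᶠ u : Xf × Yf in 𝓝 0, u ∈ B₁.prod B₂ := by
    have ho : IsOpen ((B₁.prod B₂ : AddSubgroup (Xf × Yf)) : Set (Xf × Yf)) := by
      rw [AddSubgroup.coe_prod]
      exact hB₁.prod hB₂
    exact ho.mem_nhds (zero_mem _)
  -- the squared distance as a series
  have hdist : ∀ u ∈ B₁.prod B₂, ‖rep β ψ B₁ B₂ E hψ ⟨u, 0⟩ F - F‖ ^ 2 = ∑' q, ‖χ q u - 1‖ ^ 2 * ‖F q‖ ^ 2 := by
    intro u hu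
    have h1 := lp.norm_rpow_eq_tsum h2 (rep β ψ B₁ B₂ E hψ ⟨u, 0⟩ F - F)
    rw [show (2 : ℝ≥0∞).toReal = 2 by norm_num, Real.rpow_two] at h1
    rw [h1]
    refine tsum_congr fun q => ?_
    rw [Real.rpow_two, lp.coeFn_sub, Pi.sub_apply, rep_mk_zero_apply_of_mem β ψ B₁ B₂ E hψ hu]
    change ‖χ q u • F q - F q‖ ^ 2 = _
    rw [show χ q u • F q - F q = (χ q u - 1) • F q by rw [sub_smul, one_smul], norm_smul, mul_pow]
  -- Tannery
  have hsum : Summable fun q : (Xf × Yf) ⧸ B₁.prod B₂ => 4 * ‖F q‖ ^ 2 := by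
    have := (lp.memℓp F).summable h2
    simp only [show (2 : ℝ≥0∞).toReal = 2 by norm_num, Real.rpow_two] at this
    exact this.mul_left 4
  have hlim : Tendsto (fun u : Xf × Yf => ∑' q, ‖χ q u - 1‖ ^ 2 * ‖F q‖ ^ 2) (𝓝 0) (𝓝 0) := by
    have h0 : (∑' q : (Xf × Yf) ⧸ B₁.prod B₂, ‖χ q 0 - 1‖ ^ 2 * ‖F q‖ ^ 2) = 0 := by
      simp only [hχ0, sub_self, norm_zero, ne_eq, OfNat.ofNat_ne_zero, not_false_eq_true, zero_pow, zero_mul,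
        tsum_zero]
    rw [← h0]
    refine tendsto_tsum_of_dominated_convergence hsum (fun q => ?_) (Eventually.of_forall fun u q => ?_)
    · exact ((((hχc q).sub continuous_const).norm.pow 2).mul continuous_const).tendsto 0
    · rw [Real.norm_of_nonneg (by positivity)]
      have hle : ‖χ q u - 1‖ ≤ 2 := by
        refine (norm_sub_le _ _).trans ?_
        rw [hχ, Circle.norm_coe, norm_one]
        norm_num
      calc ‖χ q u - 1‖ ^ 2 * ‖F q‖ ^ 2 ≤ 2 ^ 2 * ‖F q‖ ^ 2 :=
            mul_le_mul_of_nonneg_right (pow_le_pow_left₀ (norm_nonneg _) hle 2) (sq_nonneg _)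
        _ = 4 * ‖F q‖ ^ 2 := by norm_num
  -- conclusion
  rw [tendsto_iff_norm_sub_tendsto_zero]
  have hsq : Tendsto (fun u : Xf × Yf => ‖rep β ψ B₁ B₂ E hψ ⟨u, 0⟩ F - F‖ ^ 2) (𝓝 0) (𝓝 0) :=
    hlim.congr' (hA.mono fun u hu => (hdist u hu).symm)
  have := hsq.sqrt
  rw [Real.sqrt_zero] at this
  exact this.congr fun u => Real.sqrt_sq (norm_nonneg _)

include hB₁ hB₂ hψc hβc in
/-- **the orbit maps `w ↦ rep (w, 0) F` of the lattice model are continuous** (hypothesis `hτc` of the tree's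
Stone–von Neumann uniqueness theorems; the printed "unitary representation of `H_𝐀(W)`" continuity).
[cite: MoeglinVignerasWaldspurger1987, Chap. 2 I.3, II.8] -/
theorem continuous_rep_mk_zero (F : lp (fun _ : (Xf × Yf) ⧸ B₁.prod B₂ => E) 2) :
    Continuous fun w : Xf × Yf => rep β ψ B₁ B₂ E hψ ⟨w, 0⟩ F := by
  rw [continuous_iff_continuousAt]
  intro w₀
  have hφ : Continuous fun w : Xf × Yf => (((ψ (-(β (w - w₀).1 w₀.2)) : Circle) : ℂ)) :=
    continuous_subtype_val.comp (hψc.comp ((hβc.comp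
      ((continuous_fst.sub continuous_const).prodMk continuous_const)).neg))
  have hφ0 : (((ψ (-(β (w₀ - w₀).1 w₀.2)) : Circle) : ℂ)) = 1 := by
    rw [sub_self, Prod.fst_zero, map_zero, LinearMap.zero_apply, neg_zero, AddChar.map_zero_eq_one, Circle.coe_one]
  have h1 : Tendsto (fun w : Xf × Yf => rep β ψ B₁ B₂ E hψ ⟨w - w₀, 0⟩ (rep β ψ B₁ B₂ E hψ ⟨w₀, 0⟩ F))
      (𝓝 w₀) (𝓝 (rep β ψ B₁ B₂ E hψ ⟨w₀, 0⟩ F)) := by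
    have ht : Tendsto (fun w : Xf × Yf => w - w₀) (𝓝 w₀) (𝓝 0) := by
      have h : Tendsto (fun w : Xf × Yf => w - w₀) (𝓝 w₀) (𝓝 (w₀ - w₀)) :=
        tendsto_id.sub tendsto_const_nhds
      rwa [sub_self] at h
    exact (tendsto_rep_mk_zero β ψ B₁ B₂ E hψ hB₁ hB₂ hψc hβc _).comp ht
  have h2 := (hφ.tendsto w₀).smul h1
  rw [hφ0, one_smul] at h2
  refine (h2.congr fun w => ?_)
  exact (rep_mk_zero_eq_translate β ψ B₁ B₂ E hψ w w₀ F).symm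

/-! ## Continuity of the coefficient action and of products of actions -/

section Coeff

variable [CompleteSpace E] {G : Type*} [Group G] (π : Representation ℂ G E) (hπ : ∀ (g : G) (v : E), ‖π g v‖ = ‖v‖)

omit [TopologicalSpace Rf] [IsTopologicalAddGroup Rf] [TopologicalSpace Xf] [IsTopologicalAddGroup Xf]
  [TopologicalSpace Yf] [IsTopologicalAddGroup Yf] [CompleteSpace E] in
/-- **the coefficient representation has continuous orbit maps** along any parametrisation `φ : Y → G` along which
`π` has continuous orbit maps (Tannery again: `‖coeff(φ y)F − coeff(φ y₀)F‖² = Σ_q ‖π(φ y)(F q) − π(φ y₀)(F q)‖²`).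
[cite: GelbartRogawski1991, §3.1 p. 454 L19–21] -/
theorem continuous_coeff_apply {Y : Type*} [TopologicalSpace Y] (φ : Y → G)
    (hφ : ∀ v : E, Continuous fun y => π (φ y) v) (F : lp (fun _ : (Xf × Yf) ⧸ B₁.prod B₂ => E) 2) :
    Continuous fun y => coeff B₁ B₂ E π hπ (φ y) F := by
  have h2 : 0 < (2 : ℝ≥0∞).toReal := by norm_num
  rw [continuous_iff_continuousAt]
  intro y₀
  have hdist : ∀ y, ‖coeff B₁ B₂ E π hπ (φ y) F - coeff B₁ B₂ E π hπ (φ y₀) F‖ ^ 2 =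
      ∑' q, ‖π (φ y) (F q) - π (φ y₀) (F q)‖ ^ 2 := by
    intro y
    have h1 := lp.norm_rpow_eq_tsum h2 (coeff B₁ B₂ E π hπ (φ y) F - coeff B₁ B₂ E π hπ (φ y₀) F)
    rw [show (2 : ℝ≥0∞).toReal = 2 by norm_num, Real.rpow_two] at h1
    rw [h1]
    refine tsum_congr fun q => ?_
    rw [Real.rpow_two, lp.coeFn_sub, Pi.sub_apply, coeff_apply, coeff_apply]
  have hsum : Summable fun q : (Xf × Yf) ⧸ B₁.prod B₂ => 4 * ‖F q‖ ^ 2 := by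
    have := (lp.memℓp F).summable h2
    simp only [show (2 : ℝ≥0∞).toReal = 2 by norm_num, Real.rpow_two] at this
    exact this.mul_left 4
  have hlim : Tendsto (fun y => ∑' q, ‖π (φ y) (F q) - π (φ y₀) (F q)‖ ^ 2) (𝓝 y₀) (𝓝 0) := by
    have h0 : (∑' q : (Xf × Yf) ⧸ B₁.prod B₂, ‖π (φ y₀) (F q) - π (φ y₀) (F q)‖ ^ 2) = 0 := by
      simp only [sub_self, norm_zero, ne_eq, OfNat.ofNat_ne_zero, not_false_eq_true, zero_pow, tsum_zero]
    rw [← h0]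
    refine tendsto_tsum_of_dominated_convergence hsum (fun q => ?_) (Eventually.of_forall fun y q => ?_)
    · exact (((hφ (F q)).sub continuous_const).norm.pow 2).tendsto y₀
    · rw [Real.norm_of_nonneg (by positivity)]
      have hle : ‖π (φ y) (F q) - π (φ y₀) (F q)‖ ≤ 2 * ‖F q‖ := by
        refine (norm_sub_le _ _).trans ?_
        rw [hπ, hπ, two_mul]
      calc ‖π (φ y) (F q) - π (φ y₀) (F q)‖ ^ 2 ≤ (2 * ‖F q‖) ^ 2 :=
            pow_le_pow_left₀ (norm_nonneg _) hle 2
        _ = 4 * ‖F q‖ ^ 2 := by ring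
  change Tendsto _ _ _
  rw [tendsto_iff_norm_sub_tendsto_zero]
  have hsq : Tendsto (fun y => ‖coeff B₁ B₂ E π hπ (φ y) F - coeff B₁ B₂ E π hπ (φ y₀) F‖ ^ 2) (𝓝 y₀) (𝓝 0) :=
    hlim.congr fun y => (hdist y).symm
  have := hsq.sqrt
  rw [Real.sqrt_zero] at this
  exact this.congr fun y => Real.sqrt_sq (norm_nonneg _)

end Coeff

/-- **joint continuity for isometric actions**: if `y ↦ A y v` is continuous for every `v` and every `A y` is an
isometry, then `(y, v) ↦ A y v` is jointly continuous along continuous `f`, `g`. [cite: GelbartRogawski1991, §3.1 p. 454 L19–21] -/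
theorem continuous_apply_apply_of_isometry {Y S Z : Type*} [TopologicalSpace Y] [NormedAddCommGroup S] [Module ℂ S]
    [TopologicalSpace Z] {A : Y → S →ₗ[ℂ] S} (hA : ∀ (y : Y) (v : S), ‖A y v‖ = ‖v‖)
    (hc : ∀ v : S, Continuous fun y => A y v) {f : Z → Y} {g : Z → S} (hf : Continuous f) (hg : Continuous g) :
    Continuous fun z => A (f z) (g z) := by
  rw [continuous_iff_continuousAt]
  intro z₀
  change Tendsto _ _ _
  rw [tendsto_iff_norm_sub_tendsto_zero]
  have hb : ∀ z, ‖A (f z) (g z) - A (f z₀) (g z₀)‖ ≤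
      ‖g z - g z₀‖ + ‖A (f z) (g z₀) - A (f z₀) (g z₀)‖ := fun z => by
    calc ‖A (f z) (g z) - A (f z₀) (g z₀)‖
        = ‖A (f z) (g z - g z₀) + (A (f z) (g z₀) - A (f z₀) (g z₀))‖ := by
          rw [map_sub, sub_add_sub_cancel]
      _ ≤ ‖A (f z) (g z - g z₀)‖ + ‖A (f z) (g z₀) - A (f z₀) (g z₀)‖ := norm_add_le _ _
      _ = ‖g z - g z₀‖ + ‖A (f z) (g z₀) - A (f z₀) (g z₀)‖ := by rw [hA]
  refine squeeze_zero (fun z => norm_nonneg _) hb ?_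
  have h1 : Tendsto (fun z => ‖g z - g z₀‖) (𝓝 z₀) (𝓝 0) := by
    have h : Continuous fun z => ‖g z - g z₀‖ := (hg.sub continuous_const).norm
    simpa only [sub_self, norm_zero] using h.tendsto z₀
  have h2 : Tendsto (fun z => ‖A (f z) (g z₀) - A (f z₀) (g z₀)‖) (𝓝 z₀) (𝓝 0) := by
    have h : Continuous fun z => ‖A (f z) (g z₀) - A (f z₀) (g z₀)‖ :=
      (((hc (g z₀)).comp hf).sub continuous_const).norm
    simpa only [sub_self, norm_zero] using h.tendsto z₀
  simpa using h1.add h2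

end LatticeModel

end Literature.RepresentationTheory.HeisenbergGroup

end
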